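import Summits.ABC.ABC.Theorems.IsogenyGlueCongruenceEllipticGluingPrimeBoundStubGeomIsotypicProjector
import HarnessLib

/-!
# The geometrically-`E`-isotypic splitting of an abelian variety over `ℚ`

Stub `stub_geomIsotypicSplitting` of line `Sketch` (isotypic–Minkowski reduction) of crux U
`Summit.ABC.ABC.Theses.IsogenyGlueCongruence.EllipticGluingPrimeBound` (stmt-ABC-13919), file 2/2
(file 1/2: `…StubGeomIsotypicProjector`, the quasi-projector `exists_quasiProjector` over `ℚ̄`).

**Statement.** For abelian varieties `E`, `B` over `ℚ` with `dim E = 1` there are `B₁`, `B₂`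
over `ℚ`, a closed-immersion homomorphism `i : B₁ ↪ B` and `j : B₂ → B` with `(i, j)` an isogeny,
every non-zero geometric quotient of `B₁` receiving a non-zero homomorphism from `E_ℚ̄`,
`Hom(E_ℚ̄, B₂,ℚ̄) = 0`, and every `α : E → B` factoring through `i` (classically: the maximal
geometrically-`E`-isotypic abelian subvariety and a Poincaré complement over `ℚ`; Milne 1986,
Prop. 12.1 over the ground field, plus the Galois-orbit folklore).

**PROVED**, with no new named fact and no descent of subvarieties — descent of ONE endomorphism
replaces Poincaré over `ℚ` and Galois descent of `Gal`-stable abelian subvarieties: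
`exists_descended_quasiProjector` averages the quasi-projector of `(E ⊞ B)_ℚ̄` over the finite
image of `Gal(ℚ̄/ℚ)` in `Aut End((E ⊞ B)_ℚ̄)` (`finite_range_toRingHom_galois`; the ideal and the
relation `f ≫ e = N • f` are Galois-stable as `E` is defined over `ℚ`), descends the Galois-fixed
sum (`exists_baseChange_eq_of_forall_galConj_eq`) and cuts out its `B`-corner `u ∈ End_ℚ(B)`:
`u_ℚ̄` lies in the ideal spanned by `B_ℚ̄ → E_ℚ̄ → B_ℚ̄` and `f ≫ u_ℚ̄ = M • f`, so `u² = M u`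
(`Hom.baseChange_injective`); then `B₁ = im u`, `B₂ = im (M − u)` (`AbelianVariety.image`),
`(i, j)` is surjective with the surjective quasi-inverse `(B ↠ B₁, B ↠ B₂)` up to `[M]`, hence
an isogeny (`isIsogeny_of_surjective_of_dim_eq`), and `α ≫ (B ↠ B₁)` factors through the isogeny
`[M]_E` (`IsIsogeny.exists_comp_eq_of_kerPoints_le_of_flat_toSchemeHom`).

Everything is proved (axioms `propext`, `Classical.choice`, `Quot.sound`); no `def`, no named fact.
References: J. S. Milne, *Abelian Varieties* (Cornell–Silverman 1986), Prop. 12.1 and §16;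
D. Mumford, *Abelian Varieties* (1970), §19, Thm. 1 and Remark p. 169.
-/

noncomputable section

-- `Summit.<Summit>.<Problem>` is the mandated summit-side namespace (CONVENTIONS §2); for the
-- single-conjunct summit `ABC` the two coincide, so the duplicate `ABC.ABC` is deliberate.
set_option linter.dupNamespace false

namespace Summit.ABC.ABC.Theorems.IsotypicMinkowski

open CategoryTheory CategoryTheory.Limits AlgebraicGeometry
open Literature.AlgebraicGeometry.Motives
open Summit.ABC.ABC.Theses.IsogenyGlueCongruence
open Literature.AlgebraicGeometry.Motives.AbelianVariety

/-- **The descended `E`-isotypic quasi-projector.** For `E/ℚ` of dimension `1` and `B/ℚ` there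
are `u ∈ End_ℚ(B)` and `M ≥ 1` such that, over `ℚ̄`, `u_ℚ̄` lies in the two-sided ideal spanned
by the composites `B_ℚ̄ → E_ℚ̄ → B_ℚ̄` and `f ≫ u_ℚ̄ = M • f` for every `f : E_ℚ̄ → B_ℚ̄`: inside
`End((E ⊞ B)_ℚ̄)` average the quasi-projector `e₀` of `exists_quasiProjector` over the finite
image of `Gal(ℚ̄/ℚ)` (`finite_range_toRingHom_galois`), descend the Galois-fixed average to `ℚ`
(`exists_baseChange_eq_of_forall_galConj_eq`) and cut out its `B`-corner. -/
theorem exists_descended_quasiProjector (E B : AbelianVariety.{0} ℚ) (hE : E.dim = 1) :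
    ∃ (u : B ⟶ B) (M : ℕ), 0 < M ∧
      Hom.baseChange (AlgebraicClosure ℚ) u ∈ AddSubgroup.closure
        {z : B.baseChange (AlgebraicClosure ℚ) ⟶ B.baseChange (AlgebraicClosure ℚ) |
          ∃ (g : B.baseChange (AlgebraicClosure ℚ) ⟶ E.baseChange (AlgebraicClosure ℚ))
            (f : E.baseChange (AlgebraicClosure ℚ) ⟶ B.baseChange (AlgebraicClosure ℚ)),
            z = g ≫ f} ∧
      ∀ f : E.baseChange (AlgebraicClosure ℚ) ⟶ B.baseChange (AlgebraicClosure ℚ),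
        f ≫ Hom.baseChange (AlgebraicClosure ℚ) u = M • f := by
  haveI := normal_algebraicClosure_rat
  have hEL : (E.baseChange (AlgebraicClosure ℚ)).dim = 1 :=
    (dim_baseChange E (AlgebraicClosure ℚ)).trans hE
  obtain ⟨e₀, N₀, hN₀, he₀, hfe₀⟩ := exists_quasiProjector (E.baseChange (AlgebraicClosure ℚ)) hEL
    _ ((E ⊞ B).baseChange (AlgebraicClosure ℚ)) rfl
  set inlL := Hom.baseChange (AlgebraicClosure ℚ) (biprod.inl : E ⟶ E ⊞ B) with hinlL
  set fstL := Hom.baseChange (AlgebraicClosure ℚ) (biprod.fst : E ⊞ B ⟶ E) with hfstL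
  set inrL := Hom.baseChange (AlgebraicClosure ℚ) (biprod.inr : B ⟶ E ⊞ B) with hinrL
  set sndL := Hom.baseChange (AlgebraicClosure ℚ) (biprod.snd : E ⊞ B ⟶ B) with hsndL
  set ε := Hom.baseChange (AlgebraicClosure ℚ) (biprod.fst ≫ biprod.inl : E ⊞ B ⟶ E ⊞ B)
    with hεdef
  have h_inl_fst : inlL ≫ fstL = 𝟙 _ := by
    rw [hinlL, hfstL, ← Hom.baseChange_comp, biprod.inl_fst, Hom.baseChange_id]
  have h_inr_snd : inrL ≫ sndL = 𝟙 _ := by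
    rw [hinrL, hsndL, ← Hom.baseChange_comp, biprod.inr_snd, Hom.baseChange_id]
  have hε : ε = fstL ≫ inlL := Hom.baseChange_comp (AlgebraicClosure ℚ) _ _
  have hεgal : ∀ σ : AlgebraicClosure ℚ ≃ₐ[ℚ] AlgebraicClosure ℚ,
      (E ⊞ B).galConj (AlgebraicClosure ℚ) σ ε = ε := fun σ =>
    (E ⊞ B).galConj_baseChange (AlgebraicClosure ℚ) σ _
  -- the Galois-stable two-sided ideal `J` generated by `ε`
  set J := AddSubgroup.closure {x : (E ⊞ B).baseChange (AlgebraicClosure ℚ) ⟶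
    (E ⊞ B).baseChange (AlgebraicClosure ℚ) | ∃ a b, x = a ≫ ε ≫ b} with hJ
  have hJgen : ∀ a b : (E ⊞ B).baseChange (AlgebraicClosure ℚ) ⟶
      (E ⊞ B).baseChange (AlgebraicClosure ℚ), a ≫ ε ≫ b ∈ J :=
    fun a b => AddSubgroup.subset_closure ⟨a, b, rfl⟩
  have he₀J : e₀ ∈ J := by
    refine (AddSubgroup.closure_le (K := J)).2 ?_ he₀
    rintro x ⟨π, ι, rfl⟩
    have : π ≫ ι = (π ≫ inlL) ≫ ε ≫ (fstL ≫ ι) := by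
      rw [hε]
      simp only [Category.assoc]
      rw [reassoc_of% h_inl_fst, reassoc_of% h_inl_fst]
    rw [this]
    exact hJgen _ _
  have hJgal : ∀ (σ : AlgebraicClosure ℚ ≃ₐ[ℚ] AlgebraicClosure ℚ), ∀ x ∈ J,
      (E ⊞ B).galConj (AlgebraicClosure ℚ) σ x ∈ J := by
    intro σ
    let Φ := AddMonoidHom.mk' ((E ⊞ B).galConj (AlgebraicClosure ℚ) σ)
      ((E ⊞ B).galConj_add (AlgebraicClosure ℚ) σ)
    have hle : J ≤ J.comap Φ := by
      rw [hJ, AddSubgroup.closure_le]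
      rintro x ⟨a, b, rfl⟩
      change (E ⊞ B).galConj (AlgebraicClosure ℚ) σ (a ≫ ε ≫ b) ∈ J
      rw [(E ⊞ B).galConj_comp (AlgebraicClosure ℚ) σ,
        (E ⊞ B).galConj_comp (AlgebraicClosure ℚ) σ, hεgal]
      exact hJgen _ _
    exact fun x hx => hle hx
  -- `f ≫ (τ • e₀) = N₀ • f` for every Galois conjugate of `e₀`
  have hstar : ∀ (τ : AlgebraicClosure ℚ ≃ₐ[ℚ] AlgebraicClosure ℚ)
      (f : E.baseChange (AlgebraicClosure ℚ) ⟶ (E ⊞ B).baseChange (AlgebraicClosure ℚ)),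
      f ≫ (E ⊞ B).galConj (AlgebraicClosure ℚ) τ e₀ = N₀ • f := by
    have key : ∀ y : (E ⊞ B).baseChange (AlgebraicClosure ℚ) ⟶
        (E ⊞ B).baseChange (AlgebraicClosure ℚ), (ε ≫ y) ≫ e₀ = N₀ • (ε ≫ y) := fun y => by
      have h := hfe₀ (inlL ≫ y)
      simp only [Category.assoc] at h
      simp only [hε, Category.assoc]
      rw [h, Preadditive.comp_nsmul]
    intro τ f
    set y := fstL ≫ f with hy
    have hεy : ε ≫ y = y := by rw [hε, hy, Category.assoc, reassoc_of% h_inl_fst]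
    have h1 : (E ⊞ B).galConj (AlgebraicClosure ℚ) τ⁻¹ y ≫ e₀ =
        N₀ • (E ⊞ B).galConj (AlgebraicClosure ℚ) τ⁻¹ y := by
      have h := key ((E ⊞ B).galConj (AlgebraicClosure ℚ) τ⁻¹ y)
      rwa [← hεgal τ⁻¹, ← (E ⊞ B).galConj_comp (AlgebraicClosure ℚ) τ⁻¹, hεy] at h
    have h2 : y ≫ (E ⊞ B).galConj (AlgebraicClosure ℚ) τ e₀ = N₀ • y := by
      let Φ := AddMonoidHom.mk' ((E ⊞ B).galConj (AlgebraicClosure ℚ) τ)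
        ((E ⊞ B).galConj_add (AlgebraicClosure ℚ) τ)
      have h := congrArg Φ h1
      rw [map_nsmul] at h
      simp only [Φ, AddMonoidHom.mk'_apply] at h
      rwa [(E ⊞ B).galConj_comp (AlgebraicClosure ℚ) τ,
        ← (E ⊞ B).galConj_mul (AlgebraicClosure ℚ) τ τ⁻¹, mul_inv_cancel,
        (E ⊞ B).galConj_one (AlgebraicClosure ℚ)] at h
    calc f ≫ (E ⊞ B).galConj (AlgebraicClosure ℚ) τ e₀
        = inlL ≫ (y ≫ (E ⊞ B).galConj (AlgebraicClosure ℚ) τ e₀) := by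
          rw [hy]
          simp only [Category.assoc]
          rw [reassoc_of% h_inl_fst]
      _ = N₀ • f := by rw [h2, Preadditive.comp_nsmul, hy, reassoc_of% h_inl_fst]
  -- `Gal(ℚ̄/ℚ)` acts on `End((E ⊞ B)_ℚ̄)` through a finite group `G` of ring automorphisms
  have hfin := (E ⊞ B).finite_range_toRingHom_galois (module_finite_hom_holds _ _)
    isTorsionFree_int_hom_of_charZero
  set ρ := MulSemiringAction.toRingHom (AlgebraicClosure ℚ ≃ₐ[ℚ] AlgebraicClosure ℚ)
    (End ((E ⊞ B).baseChange (AlgebraicClosure ℚ))) with hρ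
  have hρmul : ∀ σ τ : AlgebraicClosure ℚ ≃ₐ[ℚ] AlgebraicClosure ℚ,
      (ρ σ).comp (ρ τ) = ρ (σ * τ) := fun σ τ => by
    ext x
    simp only [hρ, RingHom.coe_comp, Function.comp_apply, MulSemiringAction.toRingHom_apply,
      mul_smul]
  set G := hfin.toFinset with hG
  have hGmem : ∀ t, t ∈ G ↔ ∃ σ, ρ σ = t := fun t => hfin.mem_toFinset
  have hGne : G.Nonempty := ⟨ρ 1, (hGmem _).2 ⟨1, rfl⟩⟩
  set u : (E ⊞ B).baseChange (AlgebraicClosure ℚ) ⟶ (E ⊞ B).baseChange (AlgebraicClosure ℚ) :=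
    ∑ t ∈ G, End.asHom (t (End.of e₀)) with hu
  have hu_gal : ∀ σ : AlgebraicClosure ℚ ≃ₐ[ℚ] AlgebraicClosure ℚ,
      (E ⊞ B).galConj (AlgebraicClosure ℚ) σ u = u := by
    intro σ
    let Φ := AddMonoidHom.mk' ((E ⊞ B).galConj (AlgebraicClosure ℚ) σ)
      ((E ⊞ B).galConj_add (AlgebraicClosure ℚ) σ)
    change Φ (∑ t ∈ G, End.asHom (t (End.of e₀))) = _
    rw [map_sum]
    refine Finset.sum_nbij' (fun t => (ρ σ).comp t) (fun t => (ρ σ⁻¹).comp t) ?_ ?_ ?_ ?_ ?_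
    · intro t ht
      obtain ⟨τ, rfl⟩ := (hGmem t).1 ht
      exact (hGmem _).2 ⟨σ * τ, (hρmul σ τ).symm⟩
    · intro t ht
      obtain ⟨τ, rfl⟩ := (hGmem t).1 ht
      exact (hGmem _).2 ⟨σ⁻¹ * τ, (hρmul σ⁻¹ τ).symm⟩
    · intro t ht
      rw [← RingHom.comp_assoc, hρmul, inv_mul_cancel]
      ext x
      simp only [hρ, RingHom.coe_comp, Function.comp_apply, MulSemiringAction.toRingHom_apply,
        one_smul]
    · intro t ht
      rw [← RingHom.comp_assoc, hρmul, mul_inv_cancel]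
      ext x
      simp only [hρ, RingHom.coe_comp, Function.comp_apply, MulSemiringAction.toRingHom_apply,
        one_smul]
    · intro t ht
      rfl
  have huJ : u ∈ J := by
    refine sum_mem (fun t ht => ?_)
    obtain ⟨τ, rfl⟩ := (hGmem t).1 ht
    exact hJgal τ e₀ he₀J
  have hustar : ∀ f : E.baseChange (AlgebraicClosure ℚ) ⟶ (E ⊞ B).baseChange (AlgebraicClosure ℚ),
      f ≫ u = (G.card * N₀) • f := by
    intro f
    have hterm : ∀ t ∈ G, f ≫ End.asHom (t (End.of e₀)) = N₀ • f :=
      fun t ht => by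
        obtain ⟨τ, rfl⟩ := (hGmem t).1 ht
        exact hstar τ f
    rw [hu, Preadditive.comp_sum, Finset.sum_congr rfl hterm, Finset.sum_const, smul_smul]
  obtain ⟨uP, huP⟩ :=
    (E ⊞ B).exists_baseChange_eq_of_forall_galConj_eq (AlgebraicClosure ℚ) u hu_gal
  refine ⟨biprod.inr ≫ uP ≫ biprod.snd, G.card * N₀, Nat.mul_pos (Finset.card_pos.2 hGne) hN₀,
    ?_, ?_⟩
  · rw [Hom.baseChange_comp, Hom.baseChange_comp, huP]
    let Ψ : ((E ⊞ B).baseChange (AlgebraicClosure ℚ) ⟶ (E ⊞ B).baseChange (AlgebraicClosure ℚ)) →+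
        (B.baseChange (AlgebraicClosure ℚ) ⟶ B.baseChange (AlgebraicClosure ℚ)) :=
      AddMonoidHom.mk' (fun x => inrL ≫ x ≫ sndL)
        (fun x y => by simp only [Preadditive.comp_add, Preadditive.add_comp])
    have hle : J ≤ (AddSubgroup.closure
        {z : B.baseChange (AlgebraicClosure ℚ) ⟶ B.baseChange (AlgebraicClosure ℚ) |
          ∃ (g : B.baseChange (AlgebraicClosure ℚ) ⟶ E.baseChange (AlgebraicClosure ℚ))
            (f : E.baseChange (AlgebraicClosure ℚ) ⟶ B.baseChange (AlgebraicClosure ℚ)),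
            z = g ≫ f}).comap Ψ := by
      rw [hJ, AddSubgroup.closure_le]
      rintro x ⟨a, b, rfl⟩
      refine AddSubgroup.subset_closure ⟨inrL ≫ a ≫ fstL, inlL ≫ b ≫ sndL, ?_⟩
      simp only [Ψ, AddMonoidHom.mk'_apply, hε, Category.assoc]
    exact hle huJ
  · intro f
    rw [Hom.baseChange_comp, Hom.baseChange_comp, huP]
    have h := hustar (f ≫ inrL)
    simp only [Category.assoc] at h
    change f ≫ inrL ≫ u ≫ sndL = _
    rw [reassoc_of% h]
    simp only [Category.assoc, Preadditive.nsmul_comp, h_inr_snd, Category.comp_id]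

open scoped MonObj in
/-- STUB `stub_geomIsotypicSplitting` (geometrically-`E`-isotypic splitting over `ℚ`), PROVED:
with the descended quasi-projector `u`, `M` of `exists_descended_quasiProjector` (so `u² = M u`),
`B₁ = im u`, `B₂ = im (M - u)`; `(i, j) : B₁ ⊞ B₂ → B` has the two-sided quasi-inverse
`(B ↠ B₁, B ↠ B₂)` up to `[M]`, hence is an isogeny; a non-zero geometric quotient `C` of `B₁`
with `Hom(E_ℚ̄, C) = 0` would be killed by the ideal, whence `M • (B_ℚ̄ ↠ C) = 0`;
`Hom(E_ℚ̄, B₂,ℚ̄) = 0` as `j ≫ u = 0` while `u_ℚ̄` acts as `M` on maps from `E_ℚ̄`; and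
`α ≫ u = M • α`, so `α ≫ (B ↠ B₁)` kills `E[M]` and factors through the isogeny `[M]_E`
(`IsIsogeny.exists_comp_eq_of_kerPoints_le`), giving `α₁` with `α₁ ≫ i = α`. -/
theorem stub_geomIsotypicSplitting (E B : AbelianVariety.{0} ℚ) (hE : E.dim = 1) :
    ∃ (B₁ B₂ : AbelianVariety.{0} ℚ) (i : B₁ ⟶ B) (j : B₂ ⟶ B),
      IsClosedImmersion (AbelianVariety.Hom.toSchemeHom i) ∧
      AbelianVariety.IsIsogeny (biprod.desc i j) ∧
      (∀ (C : AbelianVariety.{0} (AlgebraicClosure ℚ))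
          (g : B₁.baseChange (AlgebraicClosure ℚ) ⟶ C),
          Surjective (AbelianVariety.Hom.toSchemeHom g) → C.dim ≠ 0 →
          ∃ f : E.baseChange (AlgebraicClosure ℚ) ⟶ C, f ≠ 0) ∧
      (∀ f : E.baseChange (AlgebraicClosure ℚ) ⟶ B₂.baseChange (AlgebraicClosure ℚ), f = 0) ∧
      ∀ α : E ⟶ B, ∃ α₁ : E ⟶ B₁, α₁ ≫ i = α := by
  obtain ⟨u, M, hM, huJ, hu⟩ := exists_descended_quasiProjector E B hE
  have hMK : ((M : ℕ) : AlgebraicClosure ℚ) ≠ 0 := by exact_mod_cast hM.ne'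
  -- `u² = M u` (checked over `ℚ̄` on the ideal, then descended by faithfulness of base change)
  have hC : ∀ z ∈ AddSubgroup.closure
      {z : B.baseChange (AlgebraicClosure ℚ) ⟶ B.baseChange (AlgebraicClosure ℚ) |
        ∃ (g : B.baseChange (AlgebraicClosure ℚ) ⟶ E.baseChange (AlgebraicClosure ℚ))
          (f : E.baseChange (AlgebraicClosure ℚ) ⟶ B.baseChange (AlgebraicClosure ℚ)), z = g ≫ f},
      z ≫ Hom.baseChange (AlgebraicClosure ℚ) u = M • z := fun z hz =>
    addMonoidHom_eq_of_mem_closure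
      (AddMonoidHom.mk' (fun z => z ≫ Hom.baseChange (AlgebraicClosure ℚ) u)
        (fun x y => Preadditive.add_comp ..))
      (AddMonoidHom.mk' (fun z => M • z) (fun x y => smul_add ..))
      (by
        rintro x ⟨g, f, rfl⟩
        change (g ≫ f) ≫ Hom.baseChange (AlgebraicClosure ℚ) u = M • (g ≫ f)
        rw [Category.assoc, hu, Preadditive.comp_nsmul]) hz
  have hu2 : u ≫ u = M • u := Hom.baseChange_injective (AlgebraicClosure ℚ) (by
    rw [Hom.baseChange_comp, baseChange_nsmul]
    exact hC _ huJ)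
  obtain ⟨v, hv⟩ : ∃ v : B ⟶ B, v = M • 𝟙 B - u := ⟨_, rfl⟩
  have huv : u ≫ v = 0 := by
    rw [hv, Preadditive.comp_sub, Preadditive.comp_nsmul, Category.comp_id, hu2, sub_self]
  have hvu : v ≫ u = 0 := by
    rw [hv, Preadditive.sub_comp, Preadditive.nsmul_comp, Category.id_comp, hu2, sub_self]
  have hvv : v ≫ v = M • v := by
    have e : v ≫ v = (M • 𝟙 B - u) ≫ v := by rw [← hv]
    rw [e, Preadditive.sub_comp, Preadditive.nsmul_comp, Category.id_comp, huv, sub_zero]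
  have huv' : u + v = M • 𝟙 B := by rw [hv, add_sub_cancel]
  have m11 : imageι u ≫ toImage u = M • 𝟙 (image u) := by
    apply eq_of_comp_eq_of_surjective (toImage u)
    apply eq_of_comp_eq_of_isClosedImmersion (imageι u)
    simp only [Category.assoc, toImage_imageι, toImage_imageι_assoc, Preadditive.nsmul_comp,
      Preadditive.comp_nsmul, Category.id_comp]
    exact hu2
  have m12 : imageι u ≫ toImage v = 0 := by
    apply eq_of_comp_eq_of_surjective (toImage u)
    apply eq_of_comp_eq_of_isClosedImmersion (imageι v)
    simp only [Category.assoc, toImage_imageι, toImage_imageι_assoc, Limits.zero_comp,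
      Limits.comp_zero]
    exact huv
  have m21 : imageι v ≫ toImage u = 0 := by
    apply eq_of_comp_eq_of_surjective (toImage v)
    apply eq_of_comp_eq_of_isClosedImmersion (imageι u)
    simp only [Category.assoc, toImage_imageι, toImage_imageι_assoc, Limits.zero_comp,
      Limits.comp_zero]
    exact hvu
  have m22 : imageι v ≫ toImage v = M • 𝟙 (image v) := by
    apply eq_of_comp_eq_of_surjective (toImage v)
    apply eq_of_comp_eq_of_isClosedImmersion (imageι v)
    simp only [Category.assoc, toImage_imageι, toImage_imageι_assoc, Preadditive.nsmul_comp,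
      Preadditive.comp_nsmul, Category.id_comp]
    exact hvv
  refine ⟨image u, image v, imageι u, imageι v, inferInstance, ?_, ?_, ?_, ?_⟩
  · -- `(i, j)` is an isogeny
    have h1 : biprod.lift (toImage u) (toImage v) ≫ biprod.desc (imageι u) (imageι v) =
        M • 𝟙 B := by
      rw [biprod.lift_desc, toImage_imageι, toImage_imageι, huv']
    have h2 : biprod.desc (imageι u) (imageι v) ≫ biprod.lift (toImage u) (toImage v) =
        M • 𝟙 _ := by
      apply biprod.hom_ext' <;> apply biprod.hom_ext <;>
        simp only [Category.assoc, biprod.lift_fst, biprod.lift_snd, biprod.inl_desc_assoc,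
          biprod.inr_desc_assoc, m11, m12, m21, m22, Preadditive.comp_nsmul,
          Preadditive.nsmul_comp, Category.comp_id, biprod.inl_fst,
          biprod.inl_snd, biprod.inr_fst, biprod.inr_snd, smul_zero]
    haveI : Surjective (Hom.toSchemeHom
        (biprod.lift (toImage u) (toImage v) ≫ biprod.desc (imageι u) (imageι v))) := by
      rw [h1]; exact surjective_nsmul_id B hM
    haveI : Surjective (Hom.toSchemeHom
        (biprod.desc (imageι u) (imageι v) ≫ biprod.lift (toImage u) (toImage v))) := by
      rw [h2]; exact surjective_nsmul_id _ hM
    haveI hφ : Surjective (Hom.toSchemeHom (biprod.desc (imageι u) (imageι v))) :=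
      surjective_of_comp (biprod.lift (toImage u) (toImage v)) _
    haveI hρ : Surjective (Hom.toSchemeHom (biprod.lift (toImage u) (toImage v))) :=
      surjective_of_comp (biprod.desc (imageι u) (imageι v)) _
    exact isIsogeny_of_surjective_of_dim_eq _ (le_antisymm
      (dim_le_of_surjective (biprod.lift (toImage u) (toImage v)))
      (dim_le_of_surjective (biprod.desc (imageι u) (imageι v))))
  · -- every non-zero geometric quotient of `B₁` receives a non-zero map from `E_ℚ̄`
    intro C g hg hCdim
    by_contra hall
    push Not at hall
    haveI := hg
    haveI : Surjective (Hom.toSchemeHom (Hom.baseChange (AlgebraicClosure ℚ) (toImage u))) :=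
      surjective_baseChange (AlgebraicClosure ℚ) (toImage u)
    have hm11L : Hom.baseChange (AlgebraicClosure ℚ) (imageι u) ≫
        Hom.baseChange (AlgebraicClosure ℚ) (toImage u) = M • 𝟙 _ := by
      rw [← Hom.baseChange_comp, m11, baseChange_nsmul, Hom.baseChange_id]
    have hfac : Hom.baseChange (AlgebraicClosure ℚ) u = Hom.baseChange (AlgebraicClosure ℚ)
        (toImage u) ≫ Hom.baseChange (AlgebraicClosure ℚ) (imageι u) := by
      rw [← Hom.baseChange_comp, toImage_imageι]
    have hkill : Hom.baseChange (AlgebraicClosure ℚ) u ≫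
        (Hom.baseChange (AlgebraicClosure ℚ) (toImage u) ≫ g) = 0 :=
      addMonoidHom_eq_of_mem_closure
        (AddMonoidHom.mk' (fun z => z ≫ (Hom.baseChange (AlgebraicClosure ℚ) (toImage u) ≫ g))
          (fun x y => Preadditive.add_comp ..)) 0
        (by
          rintro z ⟨g', f', rfl⟩
          change (g' ≫ f') ≫ (Hom.baseChange (AlgebraicClosure ℚ) (toImage u) ≫ g) = 0
          rw [Category.assoc, hall (f' ≫ _), Limits.comp_zero]) huJ
    rw [hfac, Category.assoc, reassoc_of% hm11L] at hkill
    simp only [Preadditive.nsmul_comp, Category.id_comp, Preadditive.comp_nsmul] at hkill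
    have hzero : Hom.baseChange (AlgebraicClosure ℚ) (toImage u) ≫ g = 0 :=
      eq_zero_of_nsmul_eq_zero_of_cast_ne_zero hMK hkill
    haveI : Surjective (Hom.toSchemeHom (Hom.baseChange (AlgebraicClosure ℚ) (toImage u) ≫ g)) :=
      by change Surjective (Hom.toSchemeHom _ ≫ Hom.toSchemeHom g); infer_instance
    exact hCdim (dim_eq_zero_of_surjective_zero _ hzero)
  · -- `Hom(E_ℚ̄, B₂,ℚ̄) = 0`
    intro f
    haveI : IsClosedImmersion
        (Hom.toSchemeHom (Hom.baseChange (AlgebraicClosure ℚ) (imageι v))) :=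
      isClosedImmersion_baseChange (AlgebraicClosure ℚ) _
    apply eq_of_comp_eq_of_isClosedImmersion (Hom.baseChange (AlgebraicClosure ℚ) (imageι v))
    rw [Limits.zero_comp]
    have h1 := hu (f ≫ Hom.baseChange (AlgebraicClosure ℚ) (imageι v))
    have hju : imageι v ≫ u = 0 := by
      calc imageι v ≫ u = imageι v ≫ toImage u ≫ imageι u := by rw [toImage_imageι]
        _ = 0 := by rw [reassoc_of% m21, Limits.zero_comp]
    have h2 : Hom.baseChange (AlgebraicClosure ℚ) (imageι v) ≫
        Hom.baseChange (AlgebraicClosure ℚ) u = 0 := by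
      rw [← Hom.baseChange_comp, hju]
      exact map_zero (AddMonoidHom.mk'
        (fun g : image v ⟶ B => Hom.baseChange (AlgebraicClosure ℚ) g)
        (Hom.baseChange_add (AlgebraicClosure ℚ)))
    rw [Category.assoc, h2, Limits.comp_zero] at h1
    exact eq_zero_of_nsmul_eq_zero_of_cast_ne_zero hMK h1.symm
  · -- every `α : E → B` factors through `i`
    intro α
    have hαu : α ≫ u = M • α := Hom.baseChange_injective (AlgebraicClosure ℚ) (by
      rw [Hom.baseChange_comp, baseChange_nsmul]
      exact hu _)
    have hMiso : IsIsogeny (M • 𝟙 E) := by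
      have h := isIsogeny_zsmul_id_holds E (M : ℤ) (by exact_mod_cast hM.ne')
      rwa [natCast_zsmul] at h
    obtain ⟨β, hβ⟩ := IsIsogeny.exists_comp_eq_of_kerPoints_le_of_flat_toSchemeHom (A := E)
      (B := E) (C := image u) IsIsogeny.flat_toSchemeHom_holds hMiso (α ≫ toImage u)
      (fun T x hx => by
        rw [Hom.mem_kerPoints_iff] at hx ⊢
        haveI : Mono (imageι u).hom.hom.hom := (Over.forget _).mono_of_mono_map
          (show Mono (Hom.toSchemeHom (imageι u)) from inferInstance)
        rw [← cancel_mono (imageι u).hom.hom.hom, Category.assoc, MonObj.one_comp]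
        change x ≫ ((α ≫ toImage u) ≫ imageι u).hom.hom.hom = 1
        have e1 : (α ≫ toImage u) ≫ imageι u = (M • 𝟙 E) ≫ α := by
          rw [Category.assoc, toImage_imageι, hαu, Preadditive.nsmul_comp, Category.id_comp]
        rw [e1]
        change (x ≫ (M • 𝟙 E).hom.hom.hom) ≫ α.hom.hom.hom = 1
        rw [hx, MonObj.one_comp])
    haveI : Surjective (Hom.toSchemeHom (M • 𝟙 E)) := hMiso.1
    refine ⟨β, eq_of_comp_eq_of_surjective (M • 𝟙 E) ?_⟩
    rw [← Category.assoc, hβ, Category.assoc, toImage_imageι, hαu, Preadditive.nsmul_comp,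
      Category.id_comp]

end Summit.ABC.ABC.Theorems.IsotypicMinkowski

end
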